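import Mathlib
import HarnessLib
import Literature.Geometry.DiscreteGeometry.TammesThirteen
import Summits.AtomisticToContinuum.Crystallization.Theorems.PricedLinkCensusSoftFourRingsCapFacetCap
import Summits.AtomisticToContinuum.Crystallization.Theorems.PricedLinkCensusSoftFourRingsFacetCorner

/-!
# The corner cap: every facet corner of the twelve link directions is below `136.9°`

Route `PricedLinkCensus`, item `SoftFourRings` (stmt-AtomisticToContinuum-14234), evidence
`softrings-search.md` §12.2.  Let `c` support `X` (`⟪c, ·⟫ ≤ 1` on `X`) and let `v, u, u'` be
tight (`= 1`), i.e. vertices of one facet, cocircular about the axis `c/‖c‖` at angular radius `R`,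
`cos² R = 1/‖c‖²`.  In the tangent plane at `v` the direction towards the axis is `c − v`, and the
direction `u − ⟪v,u⟫ v` towards another tight point makes an angle `β` with it,
`cos β = ⟪u − ⟪v,u⟫v, c − v⟫/(‖·‖‖·‖) = √((1 − p)/((1 + p)(‖c‖² − 1)))` (`p = ⟪v, u⟫`; this is
`cot R · tan (a/2)`, `a = ∠(v,u)`), so separation `p ≤ ca` and a small cap (`‖c‖² − 1` small) force
`cos β ≥ κ` (`inner_sub_smul_sub_ge`); two such directions then make an angle `≤ 2 arccos κ`, i.e.
`cos ≥ 2κ² − 1` (`inner_ge_of_inner_ge_mul_norm`, Cauchy–Schwarz orthogonally to `c − v`).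
For at least twelve unit vectors pairwise at inner product `≤ ca = 1 − 1/(2·(101/100)²)` and
CONDITIONAL on Tammes-13 (`FacetCap`: `‖c‖ < 2/(2 − 0.957²)`), `κ² = 135/1000` works and every
facet corner has cosine `≥ −0.73`, i.e. is `< 136.9°` (`facet_corner_cos_ge_one_percent`).
Consequence (evidence §12.2): the lone non-triangle gap (`≥ 144.3°`, cosine `≤ −0.81`) at a vertex
with three bond triangles is never a single facet corner — a non-bond hull edge issues from every such
vertex — which, with `#non-bond hull edges ≤ 6`, kills the hexagonal antiprism by counting.

**`Cap` variant** (seat c3 of stmt-AtomisticToContinuum-14234): identical to `PricedLinkCensusSoftFourRingsFacetCorner`, except that the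
global Tammes-13 hypothesis `(hT : musinTarasov2012_tammes_thirteen)` is replaced by the LOCAL covering
property of the twelve directions, `hT : ∀ p, ‖p‖ = 1 → ∃ x ∈ X, dist p x < 0.957` (no empty cap of
angular radius `57.18°`), which is all the two roots (`FacetCap`, `Interior`) ever used; the hT-free
lemmas are not repeated (the original file is imported for them).
-/

namespace Summit.AtomisticToContinuum.Crystallization.Theorems.Cap

open Real RealInnerProductSpace Literature.Geometry.DiscreteGeometry

/-- **Every facet corner of the twelve link directions is below `136.9°`** (conditional on
Tammes-13).  For at least twelve unit vectors `X` pairwise at inner product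
`≤ ca = 1 − 1/(2·(101/100)²)`, a supporting functional `c` (`⟪c, ·⟫ ≤ 1` on `X`) and three of
its tight points `v, u, u' ∈ X` with `u ≠ v`, `u' ≠ v`: the corner at `v` has cosine
`≥ 2·(135/1000) − 1 = −0.73`.  (`FacetCap`: `‖c‖² < (2/(2 − 0.957²))²`, and
`(135/1000)(1 + ca)((2/(2 − 0.957²))² − 1) ≤ 1 − ca` in exact arithmetic, margin `9·10⁻⁵`.)
[cite: MusinTarasov2012, Theorem 1] -/
theorem facet_corner_cos_ge_one_percent {X : Finset (EuclideanSpace ℝ (Fin 3))}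
    (hT : ∀ p : EuclideanSpace ℝ (Fin 3), ‖p‖ = 1 → ∃ x ∈ X, dist p x < 0.957)
    (hX1 : ∀ y ∈ X, ‖y‖ = 1) (hcard : 12 ≤ X.card)
    (hsep : ∀ u ∈ X, ∀ v ∈ X, u ≠ v → ⟪u, v⟫ ≤ 1 - 1 / (2 * (101 / 100 : ℝ) ^ 2))
    {c : EuclideanSpace ℝ (Fin 3)} (hc : ∀ y ∈ X, ⟪c, y⟫ ≤ 1) {v u u' : EuclideanSpace ℝ (Fin 3)}
    (hv : v ∈ X) (hu : u ∈ X) (hu' : u' ∈ X) (huv : u ≠ v) (hu'v : u' ≠ v) (hcv : ⟪c, v⟫ = 1)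
    (hcu : ⟪c, u⟫ = 1) (hcu' : ⟪c, u'⟫ = 1) :
    (2 * (135 / 1000 : ℝ) - 1) * (‖u - ⟪v, u⟫ • v‖ * ‖u' - ⟪v, u'⟫ • v‖) ≤
      ⟪u - ⟪v, u⟫ • v, u' - ⟪v, u'⟫ • v⟫ := by
  -- chordal separation and the Tammes bound on `‖c‖`
  have hdist : ∀ a ∈ X, ∀ b ∈ X, a ≠ b → (0.957 : ℝ) ≤ dist a b := by
    intro a ha b hb hab
    have hd : dist a b ^ 2 = 2 - 2 * ⟪a, b⟫ := by
      rw [dist_eq_norm, ← real_inner_self_eq_norm_sq, inner_sub_left, inner_sub_right,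
        inner_sub_right, real_inner_self_eq_norm_sq, real_inner_self_eq_norm_sq, hX1 a ha,
        hX1 b hb, real_inner_comm a b]
      ring
    have h2 : (0.957 : ℝ) ^ 2 ≤ dist a b ^ 2 := by
      rw [hd]; have := hsep a ha b hb hab; norm_num at this ⊢; linarith
    exact (pow_le_pow_iff_left₀ (by norm_num) dist_nonneg two_ne_zero).1 h2
  have hnorm := norm_lt_of_forall_inner_le_one hT hX1 hcard hdist hc
  have hK : ‖c‖ ^ 2 < (2 / (2 - 0.957 ^ 2)) ^ 2 :=
    pow_lt_pow_left₀ hnorm (norm_nonneg c) two_ne_zero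
  have hsqrt : Real.sqrt (135 / 1000) ^ 2 = 135 / 1000 := Real.sq_sqrt (by norm_num)
  have h := facet_corner_cos_ge (hX1 v hv) (hX1 u hu) (hX1 u' hu') huv hcv hcu hcu'
    (ca := 1 - 1 / (2 * (101 / 100 : ℝ) ^ 2)) (κ := Real.sqrt (135 / 1000)) (by norm_num)
    (hsep v hv u hu huv.symm) (hsep v hv u' hu' hu'v.symm) (Real.sqrt_nonneg _)
    (by rw [hsqrt]; norm_num) ?_
  · rwa [hsqrt] at h
  · rw [hsqrt]
    norm_num at hK ⊢
    nlinarith [hK]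

end Summit.AtomisticToContinuum.Crystallization.Theorems.Cap
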